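import Summits.QuantumFields.YangMills.Theorems.BalabanUVNodesN22KnitTwoConstants

/-!
# BalabanUVNodes ∕ node N22 = NE9 — THE TWO-CONSTANTS LETTER FOR A CONVERGENT SEQUENCE OF REAL SECTIONS (windowed kernels → (1.21) limits):
# flatness of the LIMIT on the coupling interval + uniform-margin analyticity of the APPROXIMANTS with a uniform bound ⟹ an EVENTUAL Lipschitz
# letter `(32∕s²r₁)·(2ε)^{1−s}(2B)^{s}` for the approximants — no holomorphy of the limit, no Vitali ∕ Montel passage (Track A, DAG node N22 = NE9;
# cluster K4 «SpineRates»; WIDTH SEAT `pub-ymgap-dag-n22-w1`, harness re-seat g4)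

Cell `pub-ymgap`, HUMAN RULING D-0062 (Track A) ∕ D-0149; `--kind proof --supports stmt-QuantumFields-20544 --as helper` (K3⁷ `SpineGivenEndpointR13SepCoPH`),
COUNT-NEUTRAL.  THEOREMS ONLY (0 `def`, 0 `sorry`, standard axioms); generic one-variable analysis.  Imports dag-n22-a's `…N22KnitTwoConstants`
(`norm_deriv_le_twoConstants_oneSided`; through it `Dimock2015.AnalyticLipschitz.real_param_lipschitz`) BY NAME.  The piece «ROAD 3 at the kernel record»
handed to this seat by the lane owner dag-n22-c g14 (pub-ymgap INBOX l.35203 «YOURS — GO»); this is its analytic core, consumed by the companion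
`…N22KernelFadingOfStepRateTwoConstants`.

WHY.  ROAD 3 (`N22KnitTwoConstants.coordLipschitzOn_of_osc_analytic_rpow`) turns (O) oscillation fading at node N18's rate `θ` + uniform-margin coupling analyticity
into fading Lipschitz moduli at EVERY rate above `θ` — the sharp form of node N22's memory half (`…N22KnitRoadRatesSharpTwoConstants`).  At the kernel RECORD
the objects are (1.21) LIMITS `Π_{k+1}(g; z) = lim_K Π^{(K)}_{k+1}(g; z)` of windowed finite-volume kernels ([I] (1.20)–(1.21) p. 264): node N18's letter and the
oscillation (O) live on the LIMITS (J38 §1 `osc_EA_of_kernelStepRate_decayBound`), while coupling holomorphy is a property of the finite-volume APPROXIMANTS —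
and a holomorphic extension of the limit does not follow without a Vitali ∕ Montel passage (dag-n22-c's located caveat, l.35203).  THIS FILE removes the need:
the two-constants estimate is applied AT EACH APPROXIMANT, and only its OUTPUT — a Lipschitz inequality between finitely many real points — is passed to the
limit by the consumer (`le_of_tendsto`).  The one subtlety: two constants at the approximant `K` needs flatness OF THE APPROXIMANT on the whole coupling
interval at that same `K`, whereas flatness is known for the LIMIT; the bridge is equicontinuity — Cauchy on the uniform margin makes the approximants
`(4B∕r)`-equi-Lipschitz, a finite `γ∕N`-net turns the limit's `ε`-flatness into finitely many eventual statements, and equi-Lipschitz spreads them: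
EVENTUALLY IN `K` the approximants are uniformly `2ε`-flat.

WHAT (all [folklore]).
* §1 ONE SECTION: `abs_sub_le_twoConstants_of_flat_analytic` (`f` agrees on `]0,γ]` with `F` holomorphic on `D ⊇` the closed `r`-discs about `]0,γ]`, `‖F‖ ≤ B` on
  `D`, `|f x − f y| ≤ ε` on `]0,γ]`, `0 < ε ≤ 2B` ⟹ `|f s₁ − f s₂| ≤ (32∕(s²·min(r∕2,γ∕2)))·ε^{1−s}(2B)^{s}·|s₁ − s₂|`, every `s ∈ ]0,1[` — the pointwise core of
  ROAD 3, isolated: `norm_deriv_le_twoConstants_oneSided` one-sided towards the interior + the mean value inequality), `abs_sub_le_of_analytic_margin`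
  (the same datum ⟹ `(4B∕r)`-Lipschitz, `real_param_lipschitz`).
* §2 A SEQUENCE: `exists_net_point` (the `γ∕N`-net of `]0,γ]`), ★ `eventually_flat_of_tendsto_of_lipschitz` (eventually `L`-equi-Lipschitz approximants converging
  pointwise on `]0,γ]` to an `ε`-flat limit are, for every `ε' > ε`, EVENTUALLY `ε'`-flat UNIFORMLY on `]0,γ]`).
* §3 ★★ `eventually_abs_sub_le_twoConstants` — THE SEQUENCE THEOREM: `Fk K → f` pointwise on `]0,γ]`, `f` `ε`-flat (`0 < ε ≤ B`), eventually-in-`K` holomorphic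
  extensions of `Fk K` bounded by `B` on the closed `r`-discs about `]0,γ]` ⟹ EVENTUALLY `|Fk K x − Fk K y| ≤ (32∕(s²·min(r∕2,γ∕2)))·(2ε)^{1−s}(2B)^{s}·|x − y|`.

HONEST FRAMING.  Pure analysis; count-neutral helper; nothing of Bałaban's constructed or asserted; N22 NOT discharged (typed 28∕28 · discharged 5∕27 UNMOVED —
the chair's single count line is the only count); K3⁷ OPEN, NOT claimed, skeleton v5 untouched; one finite four-torus programme at fixed ε — R4 closes the
CONDITIONAL rung `BalabanLadder.UV` only; NOT infinite volume, NOT OS on ℝ⁴, NOT a mass gap, NOT Clay.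

References (TYPES only): [I] = [Balaban1987RG1] T. Bałaban, Commun. Math. Phys. **109** (1987) 249–301 — §1 p. 263 («C^∞ (or analytic)»), (1.20)–(1.21) p. 264;
the two-constants estimate as typed in `…N22KnitTwoConstants` §§1–2; the Cauchy Lipschitz step as typed in `Dimock2015.AnalyticLipschitz` ([DimockYuan2024GNFlow] Thm 4).
-/

noncomputable section

namespace YMDAG.N22.WindowedTwoConstants

open Set Metric Filter Topology
open scoped BigOperators
open Summit.QuantumFields.YangMills.BalabanUVNodes.N22KnitTwoConstants (norm_deriv_le_twoConstants_oneSided)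
open Literature.MathematicalPhysics.QuantumFieldTheory.Dimock2015 (real_param_lipschitz)

/-! ## §1 ONE SECTION: flatness on `]0, γ]` + analyticity on the `r`-discs about it ⟹ the two-constants Lipschitz letter -/

/-- **THE TWO-CONSTANTS LIPSCHITZ LETTER OF ONE REAL SECTION** (the pointwise core of `N22KnitTwoConstants.coordLipschitzOn_of_osc_analytic_rpow`,
isolated).  `f : ℝ → ℝ` agrees on `]0, γ]` with a function `F` complex-differentiable on `D ⊇` the closed `r`-discs about `]0, γ]`, `‖F‖ ≤ B` on `D`;
`f` is FLAT on `]0, γ]`: `|f x − f y| ≤ ε` (`0 < ε ≤ 2B`).  Then for every `s ∈ ]0, 1[`: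
`|f s₁ − f s₂| ≤ (32∕(s²·min(r∕2, γ∕2)))·ε^{1−s}(2B)^{s}·|s₁ − s₂|` on `]0, γ]` — `norm_deriv_le_twoConstants_oneSided` at every point, one-sided towards
the interior, then the mean value inequality along the segment. [folklore] -/
theorem abs_sub_le_twoConstants_of_flat_analytic {f : ℝ → ℝ} {F : ℂ → ℂ} {D : Set ℂ} {γ r B ε s : ℝ}
    (hF : DifferentiableOn ℂ F D) (hFB : ∀ z ∈ D, ‖F z‖ ≤ B) (hD : ∀ t ∈ Ioc (0 : ℝ) γ, closedBall (t : ℂ) r ⊆ D)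
    (hf : ∀ t ∈ Ioc (0 : ℝ) γ, F t = (f t : ℂ))
    (hflat : ∀ x ∈ Ioc (0 : ℝ) γ, ∀ y ∈ Ioc (0 : ℝ) γ, |f x - f y| ≤ ε)
    (hε : 0 < ε) (hεB : ε ≤ 2 * B) (hr : 0 < r) (hγ : 0 < γ) (hs0 : 0 < s) (hs1 : s < 1)
    {s₁ s₂ : ℝ} (hs₁ : s₁ ∈ Ioc (0 : ℝ) γ) (hs₂ : s₂ ∈ Ioc (0 : ℝ) γ) :
    |f s₁ - f s₂| ≤ 32 / (s ^ 2 * min (r / 2) (γ / 2)) * ε ^ (1 - s) * (2 * B) ^ s * |s₁ - s₂| := by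
  set r₁ : ℝ := min (r / 2) (γ / 2) with hr₁
  have hr₁0 : 0 < r₁ := lt_min (by linarith) (by linarith)
  have hr₁r : r₁ < r := (min_le_left _ _).trans_lt (by linarith)
  have hr₁γ : 2 * r₁ ≤ γ := by have := min_le_right (r / 2) (γ / 2); linarith
  set Lip : ℝ := 32 / (s ^ 2 * r₁) * ε ^ (1 - s) * (2 * B) ^ s with hLip
  have hderiv : ∀ t ∈ Ioc (0 : ℝ) γ, ‖deriv F t‖ ≤ Lip := by
    intro t ht
    have hball : ball (t : ℂ) r ⊆ D := ball_subset_closedBall.trans (hD t ht)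
    have hFt : DifferentiableOn ℂ F (ball (t : ℂ) r) := hF.mono hball
    have hBt : ∀ z ∈ ball (t : ℂ) r, ‖F z‖ ≤ B := fun z hz => hFB z (hball hz)
    by_cases htr : t + r₁ ≤ γ
    · refine norm_deriv_le_twoConstants_oneSided (σ := 1) (Or.inl rfl) hr₁0 hr₁r hs0 hs1 hε hεB hFt hBt fun u hu0 hur => ?_
      have hmem : t + 1 * u ∈ Ioc (0 : ℝ) γ := ⟨by linarith [ht.1], by linarith⟩
      rw [hf _ hmem, hf _ ht, ← Complex.ofReal_sub, Complex.norm_real, Real.norm_eq_abs]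
      exact hflat _ hmem _ ht
    · have htr : γ < t + r₁ := not_le.mp htr
      refine norm_deriv_le_twoConstants_oneSided (σ := -1) (Or.inr rfl) hr₁0 hr₁r hs0 hs1 hε hεB hFt hBt fun u hu0 hur => ?_
      have hmem : t + -1 * u ∈ Ioc (0 : ℝ) γ := ⟨by linarith, by linarith [ht.2]⟩
      rw [hf _ hmem, hf _ ht, ← Complex.ofReal_sub, Complex.norm_real, Real.norm_eq_abs]
      exact hflat _ hmem _ ht
  have hfd : ∀ t ∈ Ioc (0 : ℝ) γ, HasDerivWithinAt f ((deriv F t).re) (Ioc (0 : ℝ) γ) t := by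
    intro t ht
    have hDt : D ∈ 𝓝 (t : ℂ) :=
      mem_nhds_iff.mpr ⟨ball (t : ℂ) r, ball_subset_closedBall.trans (hD t ht), isOpen_ball, mem_ball_self hr⟩
    have h1 : HasDerivAt F (deriv F t) (t : ℂ) := (hF.differentiableAt hDt).hasDerivAt
    have h2 : HasDerivAt (fun x : ℝ => (F x).re) (deriv F t).re t := h1.real_of_complex
    refine h2.hasDerivWithinAt.congr (fun x hx => ?_) ?_
    · show f x = (F x).re
      rw [hf x hx, Complex.ofReal_re]
    · show f t = (F t).re
      rw [hf t ht, Complex.ofReal_re]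
  have hmv : ∀ x y : ℝ, x ∈ Ioc (0 : ℝ) γ → y ∈ Ioc (0 : ℝ) γ → x ≤ y → |f y - f x| ≤ Lip * (y - x) := by
    intro x y hx hy hxy
    have hsub : Icc x y ⊆ Ioc (0 : ℝ) γ := fun z hz => ⟨hx.1.trans_le hz.1, hz.2.trans hy.2⟩
    have h := norm_image_sub_le_of_norm_deriv_le_segment' (f := f) (f' := fun t => (deriv F t).re)
      (fun z hz => (hfd z (hsub hz)).mono hsub)
      (fun z hz => ((Complex.abs_re_le_norm _).trans (hderiv z (hsub (Ico_subset_Icc_self hz)))))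
      y (right_mem_Icc.mpr hxy)
    rw [Real.norm_eq_abs] at h
    exact h
  rcases le_total s₁ s₂ with h | h
  · rw [abs_sub_comm (f s₁) (f s₂), abs_sub_comm s₁ s₂, abs_of_nonneg (sub_nonneg.mpr h)]
    exact hmv s₁ s₂ hs₁ hs₂ h
  · rw [abs_of_nonneg (sub_nonneg.mpr h)]
    exact hmv s₂ s₁ hs₂ hs₁ h

/-- **CAUCHY ON THE MARGIN ⟹ A LIPSCHITZ SECTION** (equicontinuity source): under the same analytic datum, `|f x − f y| ≤ (4B∕r)|x − y|` on `]0, γ]`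
(`Dimock2015.real_param_lipschitz` on the segment between the two points). [folklore] -/
theorem abs_sub_le_of_analytic_margin {f : ℝ → ℝ} {F : ℂ → ℂ} {D : Set ℂ} {γ r B : ℝ}
    (hF : DifferentiableOn ℂ F D) (hFB : ∀ z ∈ D, ‖F z‖ ≤ B) (hD : ∀ t ∈ Ioc (0 : ℝ) γ, closedBall (t : ℂ) r ⊆ D)
    (hf : ∀ t ∈ Ioc (0 : ℝ) γ, F t = (f t : ℂ)) (hr : 0 < r)
    {x y : ℝ} (hx : x ∈ Ioc (0 : ℝ) γ) (hy : y ∈ Ioc (0 : ℝ) γ) :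
    |f x - f y| ≤ 4 * B / r * |x - y| := by
  have hseg : Icc (min x y) (max x y) ⊆ Ioc (0 : ℝ) γ := Set.ordConnected_Ioc.uIcc_subset hx hy
  have key := real_param_lipschitz (a := min x y) (b := max x y) hr hF hFB (fun t ht => hD t (hseg ht))
    (s := x) (t := y) ⟨min_le_left _ _, le_max_left _ _⟩ ⟨min_le_right _ _, le_max_right _ _⟩
  rwa [hf x hx, hf y hy, ← Complex.ofReal_sub, Complex.norm_real, Real.norm_eq_abs] at key

/-! ## §2 A SEQUENCE OF SECTIONS: pointwise-limit flatness + equi-Lipschitz ⟹ EVENTUAL UNIFORM flatness (finite net on `]0, γ]`) -/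

/-- A finite net on `]0, γ]`: every point of `]0, γ]` is within `γ∕N` of a point `γ(j+1)∕N`, `j < N` (`N ≥ 1`). [folklore] -/
theorem exists_net_point {γ : ℝ} (hγ : 0 < γ) {N : ℕ} (hN : 1 ≤ N) {x : ℝ} (hx : x ∈ Ioc (0 : ℝ) γ) :
    ∃ j ∈ Finset.range N, |x - γ * ((j : ℝ) + 1) / N| ≤ γ / N := by
  have hN0 : (0 : ℝ) < N := by exact_mod_cast hN
  set a : ℝ := x * N / γ with ha
  have ha0 : 0 < a := div_pos (mul_pos hx.1 hN0) hγ
  have haN : a ≤ N := by rw [ha, div_le_iff₀ hγ]; nlinarith [hx.2]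
  set c : ℕ := ⌈a⌉₊ with hc
  have hc1 : 1 ≤ c := Nat.one_le_ceil_iff.2 ha0
  have hcN : c ≤ N := Nat.ceil_le.2 haN
  refine ⟨c - 1, Finset.mem_range.2 (by omega), ?_⟩
  have hcast : ((c - 1 : ℕ) : ℝ) + 1 = c := by
    rw [Nat.cast_sub hc1]; push_cast; ring
  rw [hcast]
  have h1 : a ≤ c := Nat.le_ceil a
  have h2 : (c : ℝ) < a + 1 := Nat.ceil_lt_add_one ha0.le
  -- `x = γ a / N`, and `γ c / N − x ∈ [0, γ/N[`
  have hx' : x = γ * a / N := by rw [ha]; field_simp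
  rw [hx', abs_le]
  constructor
  · rw [show γ * a / N - γ * c / N = γ / N * (a - c) by ring]
    have : -1 ≤ a - c := by linarith
    have hγN : 0 ≤ γ / N := by positivity
    nlinarith
  · rw [show γ * a / N - γ * c / N = γ / N * (a - c) by ring]
    have : a - c ≤ 0 := by linarith
    have hγN : 0 ≤ γ / N := by positivity
    nlinarith

/-- **EVENTUAL UNIFORM FLATNESS FROM POINTWISE-LIMIT FLATNESS AND EQUI-LIPSCHITZ APPROXIMANTS.**  Real sections `Fk K` on `]0, γ]`, eventually
`L`-Lipschitz there, converging pointwise on `]0, γ]` to `f` with `|f x − f y| ≤ ε`; then for every `ε' > ε`, EVENTUALLY IN `K` the approximants are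
`ε'`-flat on the WHOLE interval: a finite `γ∕N`-net carries the limit's flatness to finitely many eventual statements, and equi-Lipschitz spreads it.
[folklore] -/
theorem eventually_flat_of_tendsto_of_lipschitz {Fk : ℕ → ℝ → ℝ} {f : ℝ → ℝ} {γ ε ε' L : ℝ} (hγ : 0 < γ) (hL : 0 ≤ L)
    (hlip : ∀ᶠ K in atTop, ∀ x ∈ Ioc (0 : ℝ) γ, ∀ y ∈ Ioc (0 : ℝ) γ, |Fk K x - Fk K y| ≤ L * |x - y|)
    (hlim : ∀ t ∈ Ioc (0 : ℝ) γ, Tendsto (fun K => Fk K t) atTop (𝓝 (f t)))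
    (hflat : ∀ x ∈ Ioc (0 : ℝ) γ, ∀ y ∈ Ioc (0 : ℝ) γ, |f x - f y| ≤ ε) (hε : ε < ε') :
    ∀ᶠ K in atTop, ∀ x ∈ Ioc (0 : ℝ) γ, ∀ y ∈ Ioc (0 : ℝ) γ, |Fk K x - Fk K y| ≤ ε' := by
  set δ : ℝ := (ε' - ε) / 4 with hδ
  have hδ0 : 0 < δ := by rw [hδ]; linarith
  -- the net size: `L γ / N ≤ δ`, `N ≥ 1`
  obtain ⟨N₀, hN₀⟩ := exists_nat_gt (L * γ / δ)
  set N : ℕ := N₀ + 1 with hN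
  have hN1 : 1 ≤ N := by omega
  have hN0 : (0 : ℝ) < N := by exact_mod_cast hN1
  have hLN : L * (γ / N) ≤ δ := by
    have h1 : L * γ / δ < N := hN₀.trans (by rw [hN]; push_cast; linarith)
    rw [div_lt_iff₀ hδ0] at h1
    rw [← mul_div_assoc, div_le_iff₀ hN0]
    linarith
  set t : ℕ → ℝ := fun j => γ * ((j : ℝ) + 1) / N with ht
  have htI : ∀ j ∈ Finset.range N, t j ∈ Ioc (0 : ℝ) γ := by
    intro j hj
    have hj' : (j : ℝ) + 1 ≤ N := by exact_mod_cast Finset.mem_range.1 hj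
    refine ⟨by positivity, ?_⟩
    rw [ht]; dsimp only
    rw [div_le_iff₀ hN0]
    nlinarith
  -- the limit's flatness at the net points, eventually for the approximants
  have hnet : ∀ᶠ K in atTop, ∀ j ∈ Finset.range N, ∀ l ∈ Finset.range N, |Fk K (t j) - Fk K (t l)| ≤ ε + δ := by
    refine (Finset.eventually_all _).2 fun j hj => (Finset.eventually_all _).2 fun l hl => ?_
    have hconv : Tendsto (fun K => |Fk K (t j) - Fk K (t l)|) atTop (𝓝 |f (t j) - f (t l)|) :=
      ((hlim _ (htI j hj)).sub (hlim _ (htI l hl))).abs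
    have hlt : |f (t j) - f (t l)| < ε + δ := by linarith [hflat _ (htI j hj) _ (htI l hl)]
    exact (Filter.Tendsto.eventually_lt_const hlt hconv).mono fun K hK => hK.le
  filter_upwards [hlip, hnet] with K hK hnetK
  intro x hx y hy
  obtain ⟨j, hj, hxj⟩ := exists_net_point hγ hN1 hx
  obtain ⟨l, hl, hyl⟩ := exists_net_point hγ hN1 hy
  have h1 : |Fk K x - Fk K (t j)| ≤ δ :=
    (hK x hx _ (htI j hj)).trans ((mul_le_mul_of_nonneg_left hxj hL).trans hLN)
  have h3 : |Fk K (t l) - Fk K y| ≤ δ := by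
    rw [abs_sub_comm]
    exact (hK y hy _ (htI l hl)).trans ((mul_le_mul_of_nonneg_left hyl hL).trans hLN)
  have h2 := hnetK j hj l hl
  calc |Fk K x - Fk K y| = |(Fk K x - Fk K (t j)) + (Fk K (t j) - Fk K (t l)) + (Fk K (t l) - Fk K y)| := by ring_nf
    _ ≤ |Fk K x - Fk K (t j)| + |Fk K (t j) - Fk K (t l)| + |Fk K (t l) - Fk K y| := abs_add_three _ _ _
    _ ≤ δ + (ε + δ) + δ := by linarith
    _ ≤ ε' := by rw [hδ]; linarith

/-! ## §3 THE SEQUENCE THEOREM: flat limit + uniformly analytic approximants ⟹ the two-constants letter EVENTUALLY -/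

/-- ★ **THE TWO-CONSTANTS LETTER FOR A CONVERGENT SEQUENCE OF SECTIONS.**  Real sections `Fk K` on `]0, γ]` converging pointwise to `f`; the LIMIT is
`ε`-flat on `]0, γ]` (`|f x − f y| ≤ ε`, `0 < ε ≤ B` — the oscillation letter of the limiting kernels, e.g. node N18's rate); EVENTUALLY IN `K` each
approximant extends to a complex-differentiable function on a set containing the closed `r`-discs about `]0, γ]`, bounded there by `B` (the windowed
coupling-holomorphy datum, uniform in `K`).  Then for every `s ∈ ]0, 1[`, EVENTUALLY IN `K`:
`|Fk K x − Fk K y| ≤ (32∕(s²·min(r∕2, γ∕2)))·(2ε)^{1−s}(2B)^{s}·|x − y|` on `]0, γ]`.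
MECHANISM: Cauchy on the margin makes the approximants `(4B∕r)`-equi-Lipschitz (§1); a finite net upgrades the limit's flatness to eventual UNIFORM
`2ε`-flatness of the approximants (§2); the two-constants letter (§1) at each such `K`.  NO holomorphy of the limit is used or produced — the letter is
an inequality between finitely many real points and passes to the limit by `le_of_tendsto` (the consumer's step), where a holomorphic extension would
need a Vitali ∕ Montel passage. [folklore] -/
theorem eventually_abs_sub_le_twoConstants {Fk : ℕ → ℝ → ℝ} {f : ℝ → ℝ} {γ r B ε s : ℝ}
    (hγ : 0 < γ) (hr : 0 < r) (hε : 0 < ε) (hεB : ε ≤ B) (hs0 : 0 < s) (hs1 : s < 1)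
    (hA : ∀ᶠ K in atTop, ∃ (F : ℂ → ℂ) (D : Set ℂ), DifferentiableOn ℂ F D ∧ (∀ z ∈ D, ‖F z‖ ≤ B) ∧
      (∀ t ∈ Ioc (0 : ℝ) γ, closedBall (t : ℂ) r ⊆ D) ∧ (∀ t ∈ Ioc (0 : ℝ) γ, F t = (Fk K t : ℂ)))
    (hlim : ∀ t ∈ Ioc (0 : ℝ) γ, Tendsto (fun K => Fk K t) atTop (𝓝 (f t)))
    (hflat : ∀ x ∈ Ioc (0 : ℝ) γ, ∀ y ∈ Ioc (0 : ℝ) γ, |f x - f y| ≤ ε) :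
    ∀ᶠ K in atTop, ∀ x ∈ Ioc (0 : ℝ) γ, ∀ y ∈ Ioc (0 : ℝ) γ,
      |Fk K x - Fk K y| ≤ 32 / (s ^ 2 * min (r / 2) (γ / 2)) * (2 * ε) ^ (1 - s) * (2 * B) ^ s * |x - y| := by
  have hB : 0 < B := hε.trans_le hεB
  -- equi-Lipschitz, eventually
  have hlip : ∀ᶠ K in atTop, ∀ x ∈ Ioc (0 : ℝ) γ, ∀ y ∈ Ioc (0 : ℝ) γ, |Fk K x - Fk K y| ≤ 4 * B / r * |x - y| := by
    filter_upwards [hA] with K hK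
    obtain ⟨F, D, hF, hFB, hD, hf⟩ := hK
    exact fun x hx y hy => abs_sub_le_of_analytic_margin hF hFB hD hf hr hx hy
  -- eventual uniform `2ε`-flatness
  have hflat2 := eventually_flat_of_tendsto_of_lipschitz (ε' := 2 * ε) hγ (by positivity) hlip hlim hflat (by linarith)
  filter_upwards [hA, hflat2] with K hK hflatK
  obtain ⟨F, D, hF, hFB, hD, hf⟩ := hK
  intro x hx y hy
  exact abs_sub_le_twoConstants_of_flat_analytic hF hFB hD hf hflatK (by positivity) (by linarith) hr hγ hs0 hs1 hx hy

end YMDAG.N22.WindowedTwoConstants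

end
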